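import Summits.ValiantsHypothesis.ValiantsHypothesis.Theorems.LacunarySymmetroidMatrixDescartesPivotRankOneOneThreeKillEight
import Summits.ValiantsHypothesis.ValiantsHypothesis.Theorems.LacunarySymmetroidMatrixDescartesPivotKillMultiplicity

/-!
# `MatrixDescartes` census — rank-one `(2,4)₁`, ONE below / THREE above, chamber (C): `Z₊ ≤ 7` BY PARITY
# (the circuit conditions (C_J), (C₁) of `…PivotRankOneOneThreeKillEight` with the kills counted WITH multiplicity; (C₂), (C₃) in the companion)

HONEST FRAMING.  Object-search cell `pub-symmetroid`, seat `val-sym-mdr-p1` (generation 26); helper file `--supports` the crux item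
stmt-ValiantsHypothesis-18050 (`Theses.LacunarySymmetroid.MatrixDescartes`, OPEN, on HOLD) with NO closure claim.  In chamber (C) of the split
`d₀ < e < d₁ < d₂ < d₃` (degree order `e+d₀ < d₀+d₁ < 2e < d₀+d₂ < e+d₁ < d₀+d₃ < e+d₂ < d₁+d₂ < e+d₃ < d₁+d₃ < d₂+d₃`) the eleven-nomial
`det F` of four rank-one letters against an index-one pivot has Descartes bound `9`; the tree has `≤ 7` outside (C)
(`…OneSidedSevenExact.sevenObject_pivotPosRoots_le_seven` ff.) and, inside (C), `≤ 8` DISTINCT roots under the four weight-dependent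
circuit conditions (generation 14, `elevenNomial_chamberC_{CJ,C1,C2,C3}_le_eight`).  THIS FILE: the same kills counted WITH MULTIPLICITY
(`…PivotKillMultiplicity.countP_posRoots_le_kills`; the terminal circuit lemma `Census.countP_posRoots_trinomial_eq_zero_of_circuit` is
already multiplicity-aware) give `pos ≤ 8` WITH multiplicity, and Descartes' PARITY — the trailing term `w₀m₀X^{e+d₀}` is negative when
letter `0` is core (`m₀ < 0`, automatic in the all-core hyperbolic normal form where `mₖ = −2tₖ`) and the leading term `w₂w₃D₂₃X^{d₂+d₃}` is
positive when letters `2, 3` are not parallel — makes the count ODD (§0 `elevenNomial_oneThree_odd`), hence **`Z₊ ≤ 7`** under (C_J) (§1) and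
(C₁) (§2): the value of the kernel SEVEN object.  So wherever the generation-14 circuit certificates apply, the rank-one all-core `1|3` row
is EXACTLY AT MOST SEVEN; the located remainder of chamber (C) not covered by any kill certificate (generation-14 memo: ≈ 1 % of samples,
one sample with no certificate at all) stays OPEN, and nothing is claimed there.  Nothing here bears on `MatrixDescartes` in its window,
on `DoorA26` / `DoorA34`, registers / credences, or `VP ≠ VNP`.

[folklore] The tree's kill engine, now with multiplicity, the circuit number [cite: IlimanDewolff2016, Theorem 3.8 (n = 1)] via the tree lemma,
Descartes' parity [cite: BasuPollackRoy2006, Thm. 2.33] via `…PivotKillMultiplicity.odd_countP_posRoots`.  The kill bookkeeping of §1–§2 is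
the generation-14 text verbatim with the two engine lemmas replaced.  No definitions, no named facts.
-/

-- `Summit.ValiantsHypothesis.ValiantsHypothesis.…` repeats a component by the D-0017 layout
-- (single-conjunct summit), which the `dupNamespace` linter flags; the name is mandated.
set_option linter.dupNamespace false

namespace Summit.ValiantsHypothesis.ValiantsHypothesis.Theorems.LacunarySymmetroidMatrixDescartes.Pivot.TwoDirections.BlockLaw

open Polynomial Matrix Finset
open scoped BigOperators
open Summit.ValiantsHypothesis.ValiantsHypothesis.Theorems.LacunarySymmetroidMatrixDescartes.Pivot.KillMult
  (countP_posRoots_le_kills odd_countP_posRoots card_posRoots_le_pred_of_odd)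
open Summit.ValiantsHypothesis.ValiantsHypothesis.Theorems.LacunarySymmetroidMatrixDescartes.Census
  (countP_posRoots_trinomial_eq_zero_of_circuit)

/-! ## 0. Parity of the `1|3` eleven-nomial -/


/-- **THE `1|3` ELEVEN-NOMIAL HAS AN ODD NUMBER OF POSITIVE ROOTS (with multiplicity).**  Split `d₀ < e < d₁ < d₂ < d₃` (any chamber):
the trailing term is the pivot–letter-0 term `w₀m₀·X^{e+d₀}` and the leading term the pair term `w₂w₃D₂₃·X^{d₂+d₃}`; if the first is negative
(letter `0` core) and the second positive (letters `2, 3` not parallel), Descartes' parity makes the count odd. [cite: BasuPollackRoy2006, Thm. 2.33] -/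
theorem elevenNomial_oneThree_odd (e d₀ d₁ d₂ d₃ : ℕ) (h0e : d₀ < e) (he1 : e < d₁) (h12 : d₁ < d₂) (h23 : d₂ < d₃)
    (dJ m₀ m₁ m₂ m₃ w₀ w₁ w₂ w₃ D01 D02 D03 D12 D13 D23 : ℝ) (htrail : w₀ * m₀ < 0) (hlead : 0 < w₂ * w₃ * D23) :
    Odd ((∑ i : Fin 11, Polynomial.C ((![dJ, w₀ * m₀, w₁ * m₁, w₂ * m₂, w₃ * m₃, w₀ * w₁ * D01, w₀ * w₂ * D02, w₀ * w₃ * D03, w₁ * w₂ * D12, w₁ * w₃ * D13, w₂ * w₃ * D23] : Fin 11 → ℝ) i) * X ^ ((![2 * e, e + d₀, e + d₁, e + d₂, e + d₃, d₀ + d₁, d₀ + d₂, d₀ + d₃, d₁ + d₂, d₁ + d₃, d₂ + d₃] : Fin 11 → ℕ) i)).roots.countP (fun x => 0 < x)) := by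
  classical
  set c : Fin 11 → ℝ := ![dJ, w₀ * m₀, w₁ * m₁, w₂ * m₂, w₃ * m₃, w₀ * w₁ * D01, w₀ * w₂ * D02, w₀ * w₃ * D03, w₁ * w₂ * D12, w₁ * w₃ * D13, w₂ * w₃ * D23] with hc
  set n : Fin 11 → ℕ := ![2 * e, e + d₀, e + d₁, e + d₂, e + d₃, d₀ + d₁, d₀ + d₂, d₀ + d₃, d₁ + d₂, d₁ + d₃, d₂ + d₃] with hn
  -- every degree is at least `e + d₀`, only `i = 1` attains it; every degree is at most `d₂ + d₃`, only `i = 10` attains it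
  have hge : ∀ i, e + d₀ ≤ n i := by
    intro i; fin_cases i <;> simp [hn] <;> omega
  have hbot : ∀ i, i ≠ (1 : Fin 11) → n i - (e + d₀) ≠ 0 := by
    intro i hi; fin_cases i <;> simp [hn] at hi ⊢ <;> omega
  have hle : ∀ i, n i - (e + d₀) ≤ d₂ + d₃ - (e + d₀) := by
    intro i; fin_cases i <;> simp [hn] <;> omega
  have htop : ∀ i, i ≠ (10 : Fin 11) → n i - (e + d₀) ≠ d₂ + d₃ - (e + d₀) := by
    intro i hi; fin_cases i <;> simp [hn] at hi ⊢ <;> omega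
  set Q : ℝ[X] := ∑ i : Fin 11, Polynomial.C (c i) * X ^ (n i - (e + d₀)) with hQ
  have hPQ : (∑ i : Fin 11, Polynomial.C (c i) * X ^ n i) = X ^ (e + d₀) * Q := by
    rw [hQ, Finset.mul_sum]
    refine Finset.sum_congr rfl fun i _ => ?_
    rw [mul_left_comm, ← pow_add, Nat.add_sub_cancel' (hge i)]
  have hQ0 : Q.coeff 0 = w₀ * m₀ := by
    rw [hQ, finsetSum_coeff, Finset.sum_eq_single (1 : Fin 11)]
    · have h1 : n 1 = e + d₀ := by simp [hn]
      have c1 : c 1 = w₀ * m₀ := by simp [hc]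
      rw [h1, c1, Nat.sub_self, coeff_C_mul_X_pow, if_pos rfl]
    · intro i _ hi
      rw [coeff_C_mul_X_pow, if_neg (fun h => hbot i hi h.symm)]
    · intro h; exact absurd (Finset.mem_univ _) h
  have hQN : Q.coeff (d₂ + d₃ - (e + d₀)) = w₂ * w₃ * D23 := by
    rw [hQ, finsetSum_coeff, Finset.sum_eq_single (10 : Fin 11)]
    · have h10 : n 10 = d₂ + d₃ := by simp [hn]
      have c10 : c 10 = w₂ * w₃ * D23 := by simp [hc]
      rw [h10, c10, coeff_C_mul_X_pow, if_pos rfl]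
    · intro i _ hi
      rw [coeff_C_mul_X_pow, if_neg (fun h => htop i hi h.symm)]
    · intro h; exact absurd (Finset.mem_univ _) h
  have hdeg : Q.natDegree ≤ d₂ + d₃ - (e + d₀) := by
    rw [hQ]
    refine Polynomial.natDegree_sum_le_of_forall_le _ _ fun i _ => ?_
    exact (natDegree_C_mul_X_pow_le (c i) _).trans (hle i)
  have hnat : Q.natDegree = d₂ + d₃ - (e + d₀) :=
    Polynomial.natDegree_eq_of_le_of_coeff_ne_zero hdeg (by rw [hQN]; exact hlead.ne')
  have hleadQ : 0 < Q.leadingCoeff := by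
    rw [Polynomial.leadingCoeff, hnat, hQN]; exact hlead
  exact odd_countP_posRoots _ Q (e + d₀) hPQ (by rw [hQ0]; exact htrail) hleadQ


/-! ## 1. (C_J) -/

/-- **(C_J): the pivot term `|det J|·Π` at `2e` against the pair terms at `d₀+d₁`, `d₀+d₂`, chamber (C): `Z₊ ≤ 7`.**  As the tree's `elevenNomial_chamberC_CJ_le_eight` (same exponent hypotheses and circuit condition; coefficient data
otherwise arbitrary), plus the two sign hypotheses that make the count odd — letter `0` core (`m₀ < 0`) and letters `2, 3` not parallel
(`D₂₃ > 0`): eight kills counted WITH multiplicity leave a root-free circuit trinomial, so `pos ≤ 8` with multiplicity, and parity gives `7`. -/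
theorem elevenNomial_chamberC_CJ_le_seven (e d₀ d₁ d₂ d₃ : ℕ) (h0e : d₀ < e) (he1 : e < d₁) (h12 : d₁ < d₂) (h23 : d₂ < d₃)
    (hC1 : d₀ + d₁ < 2 * e) (hC2 : 2 * e < d₀ + d₂) (hC3 : d₀ + d₂ < e + d₁)
    (dJ m₀ m₁ m₂ m₃ w₀ w₁ w₂ w₃ D01 D02 D03 D12 D13 D23 : ℝ) (hw₀ : 0 < w₀) (hw₁ : 0 < w₁) (hw₂ : 0 < w₂) (hD01 : 0 < D01) (hD02 : 0 < D02) (hw₃ : 0 < w₃) (hm₀ : m₀ < 0) (hD23 : 0 < D23)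
    (hcirc : ((-dJ)
        * (((e : ℝ) - d₀) * ((d₁ : ℝ) - e) * ((d₂ : ℝ) - e) * ((d₃ : ℝ) - e) * ((d₀ : ℝ) + d₃ - 2 * e) * ((d₁ : ℝ) + d₂ - 2 * e) * ((d₁ : ℝ) + d₃ - 2 * e) * ((d₂ : ℝ) + d₃ - 2 * e))) ^ (2 * e - d₀ - d₁ + ((d₀ + d₂) - 2 * e)) * (((((d₀ + d₂) - 2 * e : ℕ) : ℝ)) ^ ((d₀ + d₂) - 2 * e) * (((2 * e - d₀ - d₁ : ℕ) : ℝ)) ^ (2 * e - d₀ - d₁))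
      < (((2 * e - d₀ - d₁ + ((d₀ + d₂) - 2 * e) : ℕ) : ℝ)) ^ (2 * e - d₀ - d₁ + ((d₀ + d₂) - 2 * e))
        * ((w₀ * w₁ * D01
          * (((d₁ : ℝ) - e) * ((e : ℝ) - d₀) * ((e : ℝ) + d₂ - d₀ - d₁) * ((e : ℝ) + d₃ - d₀ - d₁) * ((d₃ : ℝ) - d₁) * ((d₂ : ℝ) - d₀) * ((d₃ : ℝ) - d₀) * ((d₂ : ℝ) + d₃ - d₀ - d₁))) ^ ((d₀ + d₂) - 2 * e)
          * (w₀ * w₂ * D02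
          * (((d₂ : ℝ) - e) * ((e : ℝ) + d₁ - d₀ - d₂) * ((e : ℝ) - d₀) * ((e : ℝ) + d₃ - d₀ - d₂) * ((d₃ : ℝ) - d₂) * ((d₁ : ℝ) - d₀) * ((d₁ : ℝ) + d₃ - d₀ - d₂) * ((d₃ : ℝ) - d₀))) ^ (2 * e - d₀ - d₁))) :
    ((∑ i : Fin 11, Polynomial.C ((![dJ, w₀ * m₀, w₁ * m₁, w₂ * m₂, w₃ * m₃, w₀ * w₁ * D01, w₀ * w₂ * D02, w₀ * w₃ * D03, w₁ * w₂ * D12, w₁ * w₃ * D13, w₂ * w₃ * D23] : Fin 11 → ℝ) i) * X ^ ((![2 * e, e + d₀, e + d₁, e + d₂, e + d₃, d₀ + d₁, d₀ + d₂, d₀ + d₃, d₁ + d₂, d₁ + d₃, d₂ + d₃] : Fin 11 → ℕ) i)).roots.toFinset.filter (fun t => 0 < t)).card ≤ 7 := by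
  classical
  have h8 : (∑ i : Fin 11, Polynomial.C ((![dJ, w₀ * m₀, w₁ * m₁, w₂ * m₂, w₃ * m₃, w₀ * w₁ * D01, w₀ * w₂ * D02, w₀ * w₃ * D03, w₁ * w₂ * D12, w₁ * w₃ * D13, w₂ * w₃ * D23] : Fin 11 → ℝ) i) * X ^ ((![2 * e, e + d₀, e + d₁, e + d₂, e + d₃, d₀ + d₁, d₀ + d₂, d₀ + d₃, d₁ + d₂, d₁ + d₃, d₂ + d₃] : Fin 11 → ℕ) i)).roots.countP (fun x => 0 < x) ≤ 8 := by
    have h0e' : (d₀ : ℝ) < e := by exact_mod_cast h0e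
    have he1' : (e : ℝ) < d₁ := by exact_mod_cast he1
    have h12' : (d₁ : ℝ) < d₂ := by exact_mod_cast h12
    have h23' : (d₂ : ℝ) < d₃ := by exact_mod_cast h23
    have hC1' : (d₀ : ℝ) + d₁ < 2 * e := by exact_mod_cast hC1
    have hC2' : 2 * (e : ℝ) < d₀ + d₂ := by exact_mod_cast hC2
    have hC3' : (d₀ : ℝ) + d₂ < e + d₁ := by exact_mod_cast hC3
    -- the three distance products
    obtain ⟨PA, hPA⟩ : ∃ x : ℝ, x = ((d₁ : ℝ) - e) * ((e : ℝ) - d₀) * ((e : ℝ) + d₂ - d₀ - d₁) * ((e : ℝ) + d₃ - d₀ - d₁) * ((d₃ : ℝ) - d₁) * ((d₂ : ℝ) - d₀) * ((d₃ : ℝ) - d₀) * ((d₂ : ℝ) + d₃ - d₀ - d₁) := ⟨_, rfl⟩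
    obtain ⟨PB, hPB⟩ : ∃ x : ℝ, x = ((e : ℝ) - d₀) * ((d₁ : ℝ) - e) * ((d₂ : ℝ) - e) * ((d₃ : ℝ) - e) * ((d₀ : ℝ) + d₃ - 2 * e) * ((d₁ : ℝ) + d₂ - 2 * e) * ((d₁ : ℝ) + d₃ - 2 * e) * ((d₂ : ℝ) + d₃ - 2 * e) := ⟨_, rfl⟩
    obtain ⟨PC, hPC⟩ : ∃ x : ℝ, x = ((d₂ : ℝ) - e) * ((e : ℝ) + d₁ - d₀ - d₂) * ((e : ℝ) - d₀) * ((e : ℝ) + d₃ - d₀ - d₂) * ((d₃ : ℝ) - d₂) * ((d₁ : ℝ) - d₀) * ((d₁ : ℝ) + d₃ - d₀ - d₂) * ((d₃ : ℝ) - d₀) := ⟨_, rfl⟩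
    have hPAp : 0 < PA := by
      rw [hPA]
      have f1 : 0 < ((d₁ : ℝ) - e) := by linarith
      have f2 : 0 < ((e : ℝ) - d₀) := by linarith
      have f3 : 0 < ((e : ℝ) + d₂ - d₀ - d₁) := by linarith
      have f4 : 0 < ((e : ℝ) + d₃ - d₀ - d₁) := by linarith
      have f5 : 0 < ((d₃ : ℝ) - d₁) := by linarith
      have f6 : 0 < ((d₂ : ℝ) - d₀) := by linarith
      have f7 : 0 < ((d₃ : ℝ) - d₀) := by linarith
      have f8 : 0 < ((d₂ : ℝ) + d₃ - d₀ - d₁) := by linarith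
      exact mul_pos (mul_pos (mul_pos (mul_pos (mul_pos (mul_pos (mul_pos f1 f2) f3) f4) f5) f6) f7) f8
    have hPCp : 0 < PC := by
      rw [hPC]
      have f1 : 0 < ((d₂ : ℝ) - e) := by linarith
      have f2 : 0 < ((e : ℝ) + d₁ - d₀ - d₂) := by linarith
      have f3 : 0 < ((e : ℝ) - d₀) := by linarith
      have f4 : 0 < ((e : ℝ) + d₃ - d₀ - d₂) := by linarith
      have f5 : 0 < ((d₃ : ℝ) - d₂) := by linarith
      have f6 : 0 < ((d₁ : ℝ) - d₀) := by linarith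
      have f7 : 0 < ((d₁ : ℝ) + d₃ - d₀ - d₂) := by linarith
      have f8 : 0 < ((d₃ : ℝ) - d₀) := by linarith
      exact mul_pos (mul_pos (mul_pos (mul_pos (mul_pos (mul_pos (mul_pos f1 f2) f3) f4) f5) f6) f7) f8
    -- the three surviving coefficients
    obtain ⟨A, hA⟩ : ∃ x : ℝ, x = w₀ * w₁ * D01 * PA := ⟨_, rfl⟩
    obtain ⟨B, hB⟩ : ∃ x : ℝ, x = (-dJ) * PB := ⟨_, rfl⟩
    obtain ⟨C, hC⟩ : ∃ x : ℝ, x = w₀ * w₂ * D02 * PC := ⟨_, rfl⟩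
    have hAp : 0 < A := by rw [hA]; exact mul_pos (mul_pos (mul_pos hw₀ hw₁) hD01) hPAp
    have hCp : 0 < C := by rw [hC]; exact mul_pos (mul_pos (mul_pos hw₀ hw₂) hD02) hPCp
    have hcirc' : B ^ (2 * e - d₀ - d₁ + ((d₀ + d₂) - 2 * e)) * (((((d₀ + d₂) - 2 * e : ℕ) : ℝ)) ^ ((d₀ + d₂) - 2 * e) * (((2 * e - d₀ - d₁ : ℕ) : ℝ)) ^ (2 * e - d₀ - d₁)) < (((2 * e - d₀ - d₁ + ((d₀ + d₂) - 2 * e) : ℕ) : ℝ)) ^ (2 * e - d₀ - d₁ + ((d₀ + d₂) - 2 * e)) * (A ^ ((d₀ + d₂) - 2 * e) * C ^ (2 * e - d₀ - d₁)) := by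
      rw [hA, hB, hC, hPA, hPB, hPC]; exact hcirc
    clear hcirc
    -- eight kills
    have hkills := countP_posRoots_le_kills (Finset.univ : Finset (Fin 11)) (![2 * e, e + d₀, e + d₁, e + d₂, e + d₃, d₀ + d₁, d₀ + d₂, d₀ + d₃, d₁ + d₂, d₁ + d₃, d₂ + d₃] : Fin 11 → ℕ) [e + d₀, e + d₁, e + d₂, e + d₃, d₀ + d₃, d₁ + d₂, d₁ + d₃, d₂ + d₃] (![dJ, w₀ * m₀, w₁ * m₁, w₂ * m₂, w₃ * m₃, w₀ * w₁ * D01, w₀ * w₂ * D02, w₀ * w₃ * D03, w₁ * w₂ * D12, w₁ * w₃ * D13, w₂ * w₃ * D23] : Fin 11 → ℝ)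
    have htri : (∑ i ∈ (Finset.univ : Finset (Fin 11)), Polynomial.C ((![dJ, w₀ * m₀, w₁ * m₁, w₂ * m₂, w₃ * m₃, w₀ * w₁ * D01, w₀ * w₂ * D02, w₀ * w₃ * D03, w₁ * w₂ * D12, w₁ * w₃ * D13, w₂ * w₃ * D23] : Fin 11 → ℝ) i
            * (([e + d₀, e + d₁, e + d₂, e + d₃, d₀ + d₃, d₁ + d₂, d₁ + d₃, d₂ + d₃]).map (fun ρ : ℕ => (((((![2 * e, e + d₀, e + d₁, e + d₂, e + d₃, d₀ + d₁, d₀ + d₂, d₀ + d₃, d₁ + d₂, d₁ + d₃, d₂ + d₃] : Fin 11 → ℕ)) i : ℕ) : ℝ) - (ρ : ℝ)))).prod) * X ^ ((![2 * e, e + d₀, e + d₁, e + d₂, e + d₃, d₀ + d₁, d₀ + d₂, d₀ + d₃, d₁ + d₂, d₁ + d₃, d₂ + d₃] : Fin 11 → ℕ) i))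
        = -(Polynomial.C A * X ^ (d₀ + d₁) - Polynomial.C B * X ^ (d₀ + d₁ + (2 * e - d₀ - d₁)) + Polynomial.C C * X ^ (d₀ + d₁ + (2 * e - d₀ - d₁) + ((d₀ + d₂) - 2 * e))) := by
      have e1 : d₀ + d₁ + (2 * e - d₀ - d₁) = 2 * e := by omega
      have e2 : d₀ + d₁ + (2 * e - d₀ - d₁) + ((d₀ + d₂) - 2 * e) = d₀ + d₂ := by omega
      rw [e2, e1]
      have hcoef : ∀ i : Fin 11, (![dJ, w₀ * m₀, w₁ * m₁, w₂ * m₂, w₃ * m₃, w₀ * w₁ * D01, w₀ * w₂ * D02, w₀ * w₃ * D03, w₁ * w₂ * D12, w₁ * w₃ * D13, w₂ * w₃ * D23] : Fin 11 → ℝ) i * (([e + d₀, e + d₁, e + d₂, e + d₃, d₀ + d₃, d₁ + d₂, d₁ + d₃, d₂ + d₃]).map (fun ρ : ℕ => (((((![2 * e, e + d₀, e + d₁, e + d₂, e + d₃, d₀ + d₁, d₀ + d₂, d₀ + d₃, d₁ + d₂, d₁ + d₃, d₂ + d₃] : Fin 11 → ℕ)) i : ℕ) : ℝ) - (ρ :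 ℝ)))).prod
          = (![B, 0, 0, 0, 0, -A, -C, 0, 0, 0, 0] : Fin 11 → ℝ) i := by
        intro i
        fin_cases i <;>
          simp only [Fin.zero_eta, Fin.mk_one, Fin.isValue, Matrix.cons_val_zero, Matrix.cons_val_one,
            List.map_cons, List.map_nil, List.prod_cons, List.prod_nil, hA, hB, hC, hPA, hPB, hPC] <;>
          push_cast <;> ring
      rw [Finset.sum_congr rfl (fun i _ => by rw [hcoef i])]
      simp only [Fin.sum_univ_succ, Fin.sum_univ_zero, Matrix.cons_val_zero, Matrix.cons_val_succ, map_zero, zero_mul,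
        zero_add, add_zero, Polynomial.C_neg]
      ring
    rw [htri, Polynomial.roots_neg] at hkills
    have hzero := countP_posRoots_trinomial_eq_zero_of_circuit A B C (d₀ + d₁) (2 * e - d₀ - d₁) ((d₀ + d₂) - 2 * e) hAp hCp (by omega) (by omega) (Or.inr hcirc')
    simp only [List.length_cons, List.length_nil] at hkills
    omega
  have hodd := elevenNomial_oneThree_odd e d₀ d₁ d₂ d₃ h0e he1 h12 h23 dJ m₀ m₁ m₂ m₃ w₀ w₁ w₂ w₃ D01 D02 D03 D12 D13 D23
    (mul_neg_of_pos_of_neg hw₀ hm₀) (mul_pos (mul_pos hw₂ hw₃) hD23)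
  have h7 := card_posRoots_le_pred_of_odd _ 4 hodd (by omega)
  omega


/-! ## 2. (C₁) -/

/-- **(C₁): the letter-`1` term at `e+d₁` against the pair terms at `d₀+d₂`, `d₀+d₃`, chamber (C): `Z₊ ≤ 7`.**  As the tree's `elevenNomial_chamberC_C1_le_eight` (same exponent hypotheses and circuit condition; coefficient data
otherwise arbitrary), plus the two sign hypotheses that make the count odd — letter `0` core (`m₀ < 0`) and letters `2, 3` not parallel
(`D₂₃ > 0`): eight kills counted WITH multiplicity leave a root-free circuit trinomial, so `pos ≤ 8` with multiplicity, and parity gives `7`. -/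
theorem elevenNomial_chamberC_C1_le_seven (e d₀ d₁ d₂ d₃ : ℕ) (h0e : d₀ < e) (he1 : e < d₁) (h12 : d₁ < d₂) (h23 : d₂ < d₃)
    (hC2 : 2 * e < d₀ + d₂) (hC3 : d₀ + d₂ < e + d₁) (hC4 : e + d₁ < d₀ + d₃) (hC5 : d₀ + d₃ < e + d₂)
    (dJ m₀ m₁ m₂ m₃ w₀ w₁ w₂ w₃ D01 D02 D03 D12 D13 D23 : ℝ) (hw₀ : 0 < w₀) (hw₂ : 0 < w₂) (hw₃ : 0 < w₃) (hD02 : 0 < D02) (hD03 : 0 < D03) (hm₀ : m₀ < 0) (hD23 : 0 < D23)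
    (hcirc : (w₁ * (-m₁)
        * (((d₁ : ℝ) - e) * ((d₁ : ℝ) - d₀) * ((d₂ : ℝ) - d₁) * ((d₃ : ℝ) - d₁) * ((e : ℝ) - d₀) * ((d₂ : ℝ) - e) * ((d₃ : ℝ) - e) * ((d₂ : ℝ) + d₃ - e - d₁))) ^ ((e + d₁) - d₀ - d₂ + ((d₀ + d₃) - e - d₁)) * (((((d₀ + d₃) - e - d₁ : ℕ) : ℝ)) ^ ((d₀ + d₃) - e - d₁) * ((((e + d₁) - d₀ - d₂ : ℕ) : ℝ)) ^ ((e + d₁) - d₀ - d₂))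
      < ((((e + d₁) - d₀ - d₂ + ((d₀ + d₃) - e - d₁) : ℕ) : ℝ)) ^ ((e + d₁) - d₀ - d₂ + ((d₀ + d₃) - e - d₁))
        * ((w₀ * w₂ * D02
          * (((d₀ : ℝ) + d₂ - 2 * e) * ((d₂ : ℝ) - e) * ((e : ℝ) - d₀) * ((e : ℝ) + d₃ - d₀ - d₂) * ((d₂ : ℝ) - d₁) * ((d₁ : ℝ) - d₀) * ((d₁ : ℝ) + d₃ - d₀ - d₂) * ((d₃ : ℝ) - d₀))) ^ ((d₀ + d₃) - e - d₁)
          * (w₀ * w₃ * D03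
          * (((d₀ : ℝ) + d₃ - 2 * e) * ((d₃ : ℝ) - e) * ((e : ℝ) + d₂ - d₀ - d₃) * ((e : ℝ) - d₀) * ((d₃ : ℝ) - d₁) * ((d₁ : ℝ) + d₂ - d₀ - d₃) * ((d₁ : ℝ) - d₀) * ((d₂ : ℝ) - d₀))) ^ ((e + d₁) - d₀ - d₂))) :
    ((∑ i : Fin 11, Polynomial.C ((![dJ, w₀ * m₀, w₁ * m₁, w₂ * m₂, w₃ * m₃, w₀ * w₁ * D01, w₀ * w₂ * D02, w₀ * w₃ * D03, w₁ * w₂ * D12, w₁ * w₃ * D13, w₂ * w₃ * D23] : Fin 11 → ℝ) i) * X ^ ((![2 * e, e + d₀, e + d₁, e + d₂, e + d₃, d₀ + d₁, d₀ + d₂, d₀ + d₃, d₁ + d₂, d₁ + d₃, d₂ + d₃] : Fin 11 → ℕ) i)).roots.toFinset.filter (fun t => 0 < t)).card ≤ 7 := by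
  classical
  have h8 : (∑ i : Fin 11, Polynomial.C ((![dJ, w₀ * m₀, w₁ * m₁, w₂ * m₂, w₃ * m₃, w₀ * w₁ * D01, w₀ * w₂ * D02, w₀ * w₃ * D03, w₁ * w₂ * D12, w₁ * w₃ * D13, w₂ * w₃ * D23] : Fin 11 → ℝ) i) * X ^ ((![2 * e, e + d₀, e + d₁, e + d₂, e + d₃, d₀ + d₁, d₀ + d₂, d₀ + d₃, d₁ + d₂, d₁ + d₃, d₂ + d₃] : Fin 11 → ℕ) i)).roots.countP (fun x => 0 < x) ≤ 8 := by
    have h0e' : (d₀ : ℝ) < e := by exact_mod_cast h0e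
    have he1' : (e : ℝ) < d₁ := by exact_mod_cast he1
    have h12' : (d₁ : ℝ) < d₂ := by exact_mod_cast h12
    have h23' : (d₂ : ℝ) < d₃ := by exact_mod_cast h23
    have hC2' : 2 * (e : ℝ) < d₀ + d₂ := by exact_mod_cast hC2
    have hC3' : (d₀ : ℝ) + d₂ < e + d₁ := by exact_mod_cast hC3
    have hC4' : (e : ℝ) + d₁ < d₀ + d₃ := by exact_mod_cast hC4
    have hC5' : (d₀ : ℝ) + d₃ < e + d₂ := by exact_mod_cast hC5
    -- the three distance products
    obtain ⟨PA, hPA⟩ : ∃ x : ℝ, x = ((d₀ : ℝ) + d₂ - 2 * e) * ((d₂ : ℝ) - e) * ((e : ℝ) - d₀) * ((e : ℝ) + d₃ - d₀ - d₂) * ((d₂ : ℝ) - d₁) * ((d₁ : ℝ) - d₀) * ((d₁ : ℝ) + d₃ - d₀ - d₂) * ((d₃ : ℝ) - d₀) := ⟨_, rfl⟩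
    obtain ⟨PB, hPB⟩ : ∃ x : ℝ, x = ((d₁ : ℝ) - e) * ((d₁ : ℝ) - d₀) * ((d₂ : ℝ) - d₁) * ((d₃ : ℝ) - d₁) * ((e : ℝ) - d₀) * ((d₂ : ℝ) - e) * ((d₃ : ℝ) - e) * ((d₂ : ℝ) + d₃ - e - d₁) := ⟨_, rfl⟩
    obtain ⟨PC, hPC⟩ : ∃ x : ℝ, x = ((d₀ : ℝ) + d₃ - 2 * e) * ((d₃ : ℝ) - e) * ((e : ℝ) + d₂ - d₀ - d₃) * ((e : ℝ) - d₀) * ((d₃ : ℝ) - d₁) * ((d₁ : ℝ) + d₂ - d₀ - d₃) * ((d₁ : ℝ) - d₀) * ((d₂ : ℝ) - d₀) := ⟨_, rfl⟩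
    have hPAp : 0 < PA := by
      rw [hPA]
      have f1 : 0 < ((d₀ : ℝ) + d₂ - 2 * e) := by linarith
      have f2 : 0 < ((d₂ : ℝ) - e) := by linarith
      have f3 : 0 < ((e : ℝ) - d₀) := by linarith
      have f4 : 0 < ((e : ℝ) + d₃ - d₀ - d₂) := by linarith
      have f5 : 0 < ((d₂ : ℝ) - d₁) := by linarith
      have f6 : 0 < ((d₁ : ℝ) - d₀) := by linarith
      have f7 : 0 < ((d₁ : ℝ) + d₃ - d₀ - d₂) := by linarith
      have f8 : 0 < ((d₃ : ℝ) - d₀) := by linarith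
      exact mul_pos (mul_pos (mul_pos (mul_pos (mul_pos (mul_pos (mul_pos f1 f2) f3) f4) f5) f6) f7) f8
    have hPCp : 0 < PC := by
      rw [hPC]
      have f1 : 0 < ((d₀ : ℝ) + d₃ - 2 * e) := by linarith
      have f2 : 0 < ((d₃ : ℝ) - e) := by linarith
      have f3 : 0 < ((e : ℝ) + d₂ - d₀ - d₃) := by linarith
      have f4 : 0 < ((e : ℝ) - d₀) := by linarith
      have f5 : 0 < ((d₃ : ℝ) - d₁) := by linarith
      have f6 : 0 < ((d₁ : ℝ) + d₂ - d₀ - d₃) := by linarith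
      have f7 : 0 < ((d₁ : ℝ) - d₀) := by linarith
      have f8 : 0 < ((d₂ : ℝ) - d₀) := by linarith
      exact mul_pos (mul_pos (mul_pos (mul_pos (mul_pos (mul_pos (mul_pos f1 f2) f3) f4) f5) f6) f7) f8
    -- the three surviving coefficients
    obtain ⟨A, hA⟩ : ∃ x : ℝ, x = w₀ * w₂ * D02 * PA := ⟨_, rfl⟩
    obtain ⟨B, hB⟩ : ∃ x : ℝ, x = w₁ * (-m₁) * PB := ⟨_, rfl⟩
    obtain ⟨C, hC⟩ : ∃ x : ℝ, x = w₀ * w₃ * D03 * PC := ⟨_, rfl⟩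
    have hAp : 0 < A := by rw [hA]; exact mul_pos (mul_pos (mul_pos hw₀ hw₂) hD02) hPAp
    have hCp : 0 < C := by rw [hC]; exact mul_pos (mul_pos (mul_pos hw₀ hw₃) hD03) hPCp
    have hcirc' : B ^ ((e + d₁) - d₀ - d₂ + ((d₀ + d₃) - e - d₁)) * (((((d₀ + d₃) - e - d₁ : ℕ) : ℝ)) ^ ((d₀ + d₃) - e - d₁) * ((((e + d₁) - d₀ - d₂ : ℕ) : ℝ)) ^ ((e + d₁) - d₀ - d₂)) < ((((e + d₁) - d₀ - d₂ + ((d₀ + d₃) - e - d₁) : ℕ) : ℝ)) ^ ((e + d₁) - d₀ - d₂ + ((d₀ + d₃) - e - d₁)) * (A ^ ((d₀ + d₃) - e - d₁) * C ^ ((e + d₁) - d₀ - d₂)) := by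
      rw [hA, hB, hC, hPA, hPB, hPC]; exact hcirc
    clear hcirc
    -- eight kills
    have hkills := countP_posRoots_le_kills (Finset.univ : Finset (Fin 11)) (![2 * e, e + d₀, e + d₁, e + d₂, e + d₃, d₀ + d₁, d₀ + d₂, d₀ + d₃, d₁ + d₂, d₁ + d₃, d₂ + d₃] : Fin 11 → ℕ) [2 * e, e + d₀, e + d₂, e + d₃, d₀ + d₁, d₁ + d₂, d₁ + d₃, d₂ + d₃] (![dJ, w₀ * m₀, w₁ * m₁, w₂ * m₂, w₃ * m₃, w₀ * w₁ * D01, w₀ * w₂ * D02, w₀ * w₃ * D03, w₁ * w₂ * D12, w₁ * w₃ * D13, w₂ * w₃ * D23] : Fin 11 → ℝ)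
    have htri : (∑ i ∈ (Finset.univ : Finset (Fin 11)), Polynomial.C ((![dJ, w₀ * m₀, w₁ * m₁, w₂ * m₂, w₃ * m₃, w₀ * w₁ * D01, w₀ * w₂ * D02, w₀ * w₃ * D03, w₁ * w₂ * D12, w₁ * w₃ * D13, w₂ * w₃ * D23] : Fin 11 → ℝ) i
            * (([2 * e, e + d₀, e + d₂, e + d₃, d₀ + d₁, d₁ + d₂, d₁ + d₃, d₂ + d₃]).map (fun ρ : ℕ => (((((![2 * e, e + d₀, e + d₁, e + d₂, e + d₃, d₀ + d₁, d₀ + d₂, d₀ + d₃, d₁ + d₂, d₁ + d₃, d₂ + d₃] : Fin 11 → ℕ)) i : ℕ) : ℝ) - (ρ : ℝ)))).prod) * X ^ ((![2 * e, e + d₀, e + d₁, e + d₂, e + d₃, d₀ + d₁, d₀ + d₂, d₀ + d₃, d₁ + d₂, d₁ + d₃, d₂ + d₃] : Fin 11 → ℕ) i))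
        = -(Polynomial.C A * X ^ (d₀ + d₂) - Polynomial.C B * X ^ (d₀ + d₂ + ((e + d₁) - d₀ - d₂)) + Polynomial.C C * X ^ (d₀ + d₂ + ((e + d₁) - d₀ - d₂) + ((d₀ + d₃) - e - d₁))) := by
      have e1 : d₀ + d₂ + ((e + d₁) - d₀ - d₂) = e + d₁ := by omega
      have e2 : d₀ + d₂ + ((e + d₁) - d₀ - d₂) + ((d₀ + d₃) - e - d₁) = d₀ + d₃ := by omega
      rw [e2, e1]
      have hcoef : ∀ i : Fin 11, (![dJ, w₀ * m₀, w₁ * m₁, w₂ * m₂, w₃ * m₃, w₀ * w₁ * D01, w₀ * w₂ * D02, w₀ * w₃ * D03, w₁ * w₂ * D12, w₁ * w₃ * D13, w₂ * w₃ * D23] : Fin 11 → ℝ) i * (([2 * e, e + d₀, e + d₂, e + d₃, d₀ + d₁, d₁ + d₂, d₁ + d₃, d₂ + d₃]).map (fun ρ : ℕ => (((((![2 * e, e + d₀, e + d₁, e + d₂, e + d₃, d₀ + d₁, d₀ + d₂, d₀ + d₃, d₁ + d₂, d₁ + d₃, d₂ + d₃] : Fin 11 → ℕ)) i : ℕ)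 : ℝ) - (ρ : ℝ)))).prod
          = (![0, 0, B, 0, 0, 0, -A, -C, 0, 0, 0] : Fin 11 → ℝ) i := by
        intro i
        fin_cases i <;>
          simp only [Fin.zero_eta, Fin.mk_one, Fin.isValue, Matrix.cons_val_zero, Matrix.cons_val_one,
            List.map_cons, List.map_nil, List.prod_cons, List.prod_nil, hA, hB, hC, hPA, hPB, hPC] <;>
          push_cast <;> ring
      rw [Finset.sum_congr rfl (fun i _ => by rw [hcoef i])]
      simp only [Fin.sum_univ_succ, Fin.sum_univ_zero, Matrix.cons_val_zero, Matrix.cons_val_succ, map_zero, zero_mul,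
        zero_add, add_zero, Polynomial.C_neg]
      ring
    rw [htri, Polynomial.roots_neg] at hkills
    have hzero := countP_posRoots_trinomial_eq_zero_of_circuit A B C (d₀ + d₂) ((e + d₁) - d₀ - d₂) ((d₀ + d₃) - e - d₁) hAp hCp (by omega) (by omega) (Or.inr hcirc')
    simp only [List.length_cons, List.length_nil] at hkills
    omega
  have hodd := elevenNomial_oneThree_odd e d₀ d₁ d₂ d₃ h0e he1 h12 h23 dJ m₀ m₁ m₂ m₃ w₀ w₁ w₂ w₃ D01 D02 D03 D12 D13 D23
    (mul_neg_of_pos_of_neg hw₀ hm₀) (mul_pos (mul_pos hw₂ hw₃) hD23)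
  have h7 := card_posRoots_le_pred_of_odd _ 4 hodd (by omega)
  omega


end Summit.ValiantsHypothesis.ValiantsHypothesis.Theorems.LacunarySymmetroidMatrixDescartes.Pivot.TwoDirections.BlockLaw
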